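import Summits.CriticalPhenomena.SAWScalingLimit.Theses.SAWLoopFugacityFlow

/-!
# Crux IsingBoundaryRatio (stmt-CriticalPhenomena-10650) — ideator 2, round 1: first lemmas

Two crux idea cards, one lever each:

* `DoubleCut` — fermionic: the boundary two-point function as the boundary value of the
  two-variable fermion, localised in BOTH variables by the Hongler–Kytölä convolution kernel with
  POSITIVE weights (local boundary spin correlations of the caps); first lemma
  `DoubleCut.BoundaryAnchorRatio` = the crux for boundary-vertex anchors.
* `AnchorRenewal` — probabilistic: Edwards–Sokal + RSW renewal across conformal half-annuli at a
  rough prime end; first lemma `AnchorRenewal.AnchorIndependence` (value-free: difference of nested ratios → 0),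
  and the transfer `AnchorIndependence → BoundaryAnchorRatio → ExistsBoundaryApprox → crux`.

Everything is stated over existing declarations (`isingTwoPoint`, `discreteDomainGraph`,
`meshDomain`, `SAW.IsEndpointApprox`, the restriction-hull vocabulary of the route file).
Only the transfer `AnchorRenewal.transfer` is proved (bookkeeping); the other defs are statements
that must elaborate (`lean check` rc 0).
-/

noncomputable section

open scoped Classical Topology
open Filter Set MeasureTheory
open Literature.Probability.LatticeModels Literature.Probability.RandomPlanarGeometry

namespace Summit.CriticalPhenomena.SAWScalingLimit.Cruxes.IsingBoundaryRatio

/-- The crux's inline quantity: the free-b.c. critical Ising two-point function on the mesh graph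
`Ω_δ` (`discreteDomainGraph Ω δ`, volume = the mesh-domain finset, `β = β_c = log(1+√2)/2`,
`h = 0`), for a given locally-finite structure `lf` (a subsingleton). -/
def twoPt (lf : ∀ (Ω : Set ℂ) (δ : ℝ), (discreteDomainGraph Ω δ).LocallyFinite)
    (Ω : Set ℂ) (δ : ℝ) (x y : Site 2) : ℝ :=
  @Literature.Probability.LatticeModels.isingTwoPoint _ (discreteDomainGraph Ω δ) _ (lf Ω δ)
    (if h : Bornology.IsBounded Ω ∧ 0 < δ then (meshDomain_finite h.1 h.2).toFinset else ∅)
    (Real.log (1 + Real.sqrt 2) / 2) 0 BoundaryCondition.free x y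

/-- `D' ⊆ D` is a hull subdomain with the same marked points, agreeing with `D` in balls around
them (verbatim the crux's hypotheses h3–h6). -/
def IsNested (D D' : DobrushinDomain) : Prop :=
  D'.carrier ⊆ D.carrier ∧ D'.pt 0 = D.pt 0 ∧ D'.pt 1 = D.pt 1 ∧
    ∃ ε : ℝ, 0 < ε ∧ D'.carrier ∩ Metric.ball (D.pt 0) ε = D.carrier ∩ Metric.ball (D.pt 0) ε ∧
      D'.carrier ∩ Metric.ball (D.pt 1) ε = D.carrier ∩ Metric.ball (D.pt 1) ε

/-- The lattice anchor `a δ` is (eventually) a BOUNDARY VERTEX of `Ω_δ`: a vertex of the mesh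
domain with a `ℤ²`-neighbour not joined to it in `Ω_δ` (so a boundary medial vertex adjacent to
`a δ` exists and Hongler–Kytölä's Lemma 64 `E^free[σ_a σ_z] = α⁻¹ |f^SPIN(a_m, z_m)|` applies). -/
def IsBoundaryAnchor (Ω : Set ℂ) (a : ℝ → Site 2) : Prop :=
  ∀ᶠ δ in 𝓝[>] (0 : ℝ), a δ ∈ meshDomain Ω δ ∧
    ∃ v : Site 2, (zdGraph 2).Adj (a δ) v ∧ ¬ (discreteDomainGraph Ω δ).Adj (a δ) v

/-- The nested ratio along an endpoint approximation. -/
def ratio (lf : ∀ (Ω : Set ℂ) (δ : ℝ), (discreteDomainGraph Ω δ).LocallyFinite)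
    (D D' : DobrushinDomain) (a b : ℝ → Site 2) (δ : ℝ) : ℝ :=
  twoPt lf D'.carrier δ (a δ) (b δ) / twoPt lf D.carrier δ (a δ) (b δ)

/-- The crux's conclusion shell for a given endpoint approximation: for every chordal
uniformizer and restriction datum of the pulled-back hull, `ratio → d^{1/2}` along `𝓝[>] 0`. -/
def RatioTendsto (lf : ∀ (Ω : Set ℂ) (δ : ℝ), (discreteDomainGraph Ω δ).LocallyFinite)
    (D D' : DobrushinDomain) (a b : ℝ → Site 2) : Prop :=
  ∀ (φ : ConformalEquiv UpperHalfPlane.upperHalfPlaneSet D.carrier), D.IsChordalUniformizing φ →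
    ∀ (A : Set ℂ), A = closure (UpperHalfPlane.upperHalfPlaneSet \
        {z | z ∈ UpperHalfPlane.upperHalfPlaneSet ∧ φ z ∈ D'.carrier}) →
    ∀ (Φ : ConformalEquiv (UpperHalfPlane.upperHalfPlaneSet \ A) UpperHalfPlane.upperHalfPlaneSet)
      (d : ℝ), IsRestrictionMap A Φ → HasRestrictionDeriv A Φ d →
      Tendsto (ratio lf D D' a b) (𝓝[>] 0) (𝓝 (d ^ ((1 : ℝ) / 2)))

namespace DoubleCut

/-- FIRST LEMMA of the line `double-cut-positive-kernel`: the crux restricted to endpoint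
approximations whose anchors are boundary vertices of `Ω_δ` (then `E^free_{Ω_δ}[σ_a σ_b]` is the
boundary value of the two-variable fermion and the double convolution representation applies).
Same quantifier shell as `IsingBoundaryRatio` plus two `IsBoundaryAnchor` hypotheses. -/
def BoundaryAnchorRatio : Prop :=
  ∀ (lf : ∀ (Ω : Set ℂ) (δ : ℝ), (discreteDomainGraph Ω δ).LocallyFinite)
    (D D' : DobrushinDomain) (a b : ℝ → Site 2),
    SAW.IsEndpointApprox D a b → SAW.IsEndpointApprox D' a b → IsNested D D' →
    IsBoundaryAnchor D.carrier a → IsBoundaryAnchor D.carrier b →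
    RatioTendsto lf D D' a b

/-- Support of the same line (the reduction of rough cuts to straight cuts): GKS domain
monotonicity of the free two-point function on mesh graphs — the lattice twin of Hongler–Kytölä
Remark 26 (in tree for induced graphs: `isingCorr_free_mono_graph`). -/
def MeshMonotone : Prop :=
  ∀ (lf : ∀ (Ω : Set ℂ) (δ : ℝ), (discreteDomainGraph Ω δ).LocallyFinite)
    (Ω Ω' : Set ℂ) (δ : ℝ) (x y : Site 2), Ω' ⊆ Ω → 0 < δ → Bornology.IsBounded Ω →
    x ∈ meshDomain Ω' δ → y ∈ meshDomain Ω' δ → meshDomain Ω' δ ⊆ meshDomain Ω δ →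
    twoPt lf Ω' δ x y ≤ twoPt lf Ω δ x y

end DoubleCut

namespace AnchorRenewal

/-- FIRST LEMMA of the line `fk-anchor-renewal` (value-free): the nested ratio is asymptotically
independent of the endpoint approximation — for two endpoint approximations of the same marked
prime ends the difference of nested ratios tends to `0` (equivalently, as all ratios lie in
`[0, 1]` by GKS, the double ratio tends to `1` whenever the limit is positive). Proved in the line by Edwards–Sokal, RSW in rough
discrete quads uniformly in boundary conditions, FKG, domain Markov and renewals across conformal
half-annuli (only the separating = easy direction is ever needed, since one conditions on the
arm). -/
def AnchorIndependence : Prop :=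
  ∀ (lf : ∀ (Ω : Set ℂ) (δ : ℝ), (discreteDomainGraph Ω δ).LocallyFinite)
    (D D' : DobrushinDomain) (a b a' b' : ℝ → Site 2),
    SAW.IsEndpointApprox D a b → SAW.IsEndpointApprox D' a b →
    SAW.IsEndpointApprox D a' b' → SAW.IsEndpointApprox D' a' b' → IsNested D D' →
    Tendsto (fun δ => ratio lf D D' a b δ - ratio lf D D' a' b' δ) (𝓝[>] 0) (𝓝 0)

/-- The cross-domain half of the same lever, isolated: the one-arm probability of the anchor to a
mesoscopic conformal crosscut is asymptotically the same in `Ω_δ` and `Ω'_δ`. Stated at the level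
of two-point functions through a THIRD anchor `c` sitting on the crosscut scale: for anchors `c`
converging to boundary points `p → a`, the nested ratio of `E[σ_a σ_c]` tends to `1`
(pole/arm universality at the common rough prime end). -/
def ArmUniversality : Prop :=
  ∀ (lf : ∀ (Ω : Set ℂ) (δ : ℝ), (discreteDomainGraph Ω δ).LocallyFinite)
    (D D' : DobrushinDomain) (a : ℝ → Site 2), IsNested D D' →
    Tendsto (fun δ => meshPoint δ (a δ)) (𝓝[>] 0) (𝓝 (D.pt 0)) →
    (∀ᶠ δ in 𝓝[>] (0 : ℝ), a δ ∈ meshDomain D'.carrier δ) →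
    ∀ ε > 0, ∃ r > 0, ∀ (c : ℝ → Site 2) (p : ℂ), p ∈ frontier D.carrier → p ≠ D.pt 0 →
      dist p (D.pt 0) < r → Tendsto (fun δ => meshPoint δ (c δ)) (𝓝[>] 0) (𝓝 p) →
      (∀ᶠ δ in 𝓝[>] (0 : ℝ), (discreteDomainGraph D'.carrier δ).Reachable (a δ) (c δ)) →
      ∀ᶠ δ in 𝓝[>] (0 : ℝ),
        |twoPt lf D'.carrier δ (a δ) (c δ) / twoPt lf D.carrier δ (a δ) (c δ) - 1| ≤ ε

/-- Existence of ONE endpoint approximation by boundary vertices common to `D` and `D'`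
(bookkeeping, size S–M: nearest boundary vertices of the common piece of the mesh graphs). -/
def ExistsBoundaryApprox : Prop :=
  ∀ (D D' : DobrushinDomain), IsNested D D' →
    ∃ a b : ℝ → Site 2, SAW.IsEndpointApprox D a b ∧ SAW.IsEndpointApprox D' a b ∧
      IsBoundaryAnchor D.carrier a ∧ IsBoundaryAnchor D.carrier b

/-- TRANSFER (the line's composition shape): anchor independence + the boundary-anchor case +
one boundary approximation ⇒ the crux as typed (every `IsEndpointApprox`). Elementary filter
algebra, proved below (`transfer`). -/
def Transfer : Prop :=
  AnchorIndependence → DoubleCut.BoundaryAnchorRatio → ExistsBoundaryApprox →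
    Theses.SAWLoopFugacityFlow.IsingBoundaryRatio

/-- The transfer is pure bookkeeping (kernel-checked here): `ratio a b = ratio a' b' +
(ratio a b - ratio a' b') → d^{1/2} + 0`. -/
theorem transfer : Transfer := by
  intro hAI hBA hEx lf D D' a b hab hab' h3 h4 h5 h6 φ hφ A hA Φ d hR hD
  obtain ⟨a', b', h1, h1', hb1, hb2⟩ := hEx D D' ⟨h3, h4, h5, h6⟩
  have T1 := hBA lf D D' a' b' h1 h1' ⟨h3, h4, h5, h6⟩ hb1 hb2 φ hφ A hA Φ d hR hD
  have T2 := hAI lf D D' a b a' b' hab hab' h1 h1' ⟨h3, h4, h5, h6⟩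
  have T := T1.add T2
  have hfun : (fun δ => ratio lf D D' a' b' δ + (ratio lf D D' a b δ - ratio lf D D' a' b' δ)) =
      ratio lf D D' a b := by
    funext δ; ring
  rw [hfun, add_zero] at T
  exact T

end AnchorRenewal

end Summit.CriticalPhenomena.SAWScalingLimit.Cruxes.IsingBoundaryRatio

end
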